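import Summits.Ventures.WeilGRH.KeyOneVectorPrinciple
import Summits.Ventures.WeilGRH.KeyFamilyAverage
import Literature.NumberTheory.Sieve.LargeSieveCharacters
import HarnessLib

/-!
# GRH arm (rh-explicit, venture WeilGRH): the VARIANCE of the family around the centre of the key polytope

Cell `rh-explicit`, WEIL TRACK — GRH ARM, sequel of `KeyFamilyAverage.lean` (first moment: for `N ≤ q`
the family average of the twisted window forms `E_{χ,N}` over the characters mod `q` is the centre
`E_{a_χ, log q, 0, N}` of the polytope) and `KeyOneVectorPrinciple.lean` (affine law
`E_{χ,N}(g) − E_{a_χ,log q,0,N}(g) = −2 Re Y_χ(g)`, `Y_χ(g) = Σ_{n ≤ N} (Λ(n)/√n) χ(n) k(log n)`,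
`k = g ⋆ g̃`).  SECOND MOMENT, by orthogonality in the form `Σ_χ χ(m) conj χ(n) = φ(q)·[m ≡ n, (n,q) = 1]`
(Montgomery–Vaughan Cor. 4.5 (4.15); the tree's Parseval on `(ℤ/qℤ)ˣ`,
`Literature.NumberTheory.Sieve.LargeSieve.sum_norm_sq_sum_char_mul`, restricted to `n ≤ N < q`):

* `sum_chars_norm_sq_sum_eq` — **orthogonality below the conductor**: for `N < q` and any coefficients,
  `Σ_{χ mod q} |Σ_{n ≤ N} c_n χ(n)|² = φ(q) Σ_{n ≤ N, (n,q)=1} |c_n|²` (the equality case of the character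
  large sieve);
* `sum_chars_norm_sq_spikeSum_eq`: `Σ_χ |Y_χ(g)|² = φ(q) Σ_{n ≤ N, (n,q)=1} (Λ(n)²/n) |k(log n)|²`, `N < q`;
* `sum_chars_spikeSum_sq_eq_zero`: `Σ_χ Y_χ(g)² = 0` when `N² ≤ q` (no products `mn ≡ 1 (mod q)` with
  `1 < m, n ≤ N`);
* **the variance identity** `sum_chars_sq_sub_zero_key_eq`: for `N < q`, `N² ≤ q` and every test function,

  `Σ_{χ mod q} (E_{χ,N}(g) − E_{a_χ, log q, 0, N}(g))² = 2φ(q) Σ_{n ≤ N, (n,q)=1} (Λ(n)²/n) |(g ⋆ g̃)(log n)|²`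

  — the characters mod `q` are spread around the centre of the polytope with mean zero (first moment) and
  variance per character `2 Σ_{n ≤ N, (n,q)=1} (Λ(n)²/n)|k(log n)|² ≤ 2 (Σ_{n ≤ N} Λ(n)²/n) ‖g‖₂⁴`
  (`|k| ≤ ‖g‖₂²`, Bombieri's Lemma; `sum_chars_sq_sub_zero_key_le`), INDEPENDENT of `q`;
* **Chebyshev count** `card_filter_neg_mul_sq_le`: for `q ≥ 216` the centre value is at least
  `m_q ‖g‖₂²`, `m_q = log q − log π + ψ(¼) > 0` (`KeyFamilyAverage`), so the number of characters mod `q`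
  whose form is NEGATIVE at `g` satisfies
  `#{χ : E_{χ,N}(g) < 0} · (m_q‖g‖₂²)² ≤ 2φ(q) (Σ_{n ≤ N} Λ(n)²/n) ‖g‖₂⁴`: at most the fraction
  `2(Σ_{n ≤ N} Λ(n)²/n)/m_q²` of the family can fail at a given window vector — failure at fixed `g` is
  `O(1/log² q)`-rare in the family (per vector; positivity for all `g` at once is not a consequence).

Everything is PROVED; no named facts; RH/GRH-free.

## References
* H. L. Montgomery, R. C. Vaughan, *Multiplicative Number Theory I*, CUP 2007, Corollary 4.5 (4.14)–(4.15)
  (orthogonality of Dirichlet characters). [MontgomeryVaughan2007]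
* A. Weil, *Sur les "formules explicites" de la théorie des nombres premiers* (1952), (11) pp. 261–262.
  [Weil1952FormulesExplicites]
* E. Bombieri, *Remarks on Weil's quadratic functional in the theory of prime numbers I*, Rend. Mat. Acc.
  Lincei (9) 11 (2000), §4 Lemma 2 (`|g ⋆ g̃| ≤ ‖g‖₂²`). [Bombieri2000Weil]
-/

noncomputable section

open Complex Set MeasureTheory
open scoped Real ArithmeticFunction.vonMangoldt ComplexConjugate

namespace Summit.Ventures.WeilGRH

open Literature.NumberTheory.LFunctions

variable {q : ℕ} {g : ℝ → ℂ}

/-! ## Orthogonality below the conductor -/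

/-- **Orthogonality below the conductor (the equality case of the character large sieve)**: for `N < q`
and any coefficients `c`, `Σ_{χ mod q} |Σ_{n ≤ N} c_n χ(n)|² = φ(q) Σ_{n ≤ N, (n,q)=1} |c_n|²` — the tree's
Parseval identity on `(ℤ/qℤ)ˣ` (`LargeSieve.sum_norm_sq_sum_char_mul`, one full period) applied to the
coefficients extended by `0` on `N < n < q`. [cite: MontgomeryVaughan2007, Corollary 4.5 (4.14)–(4.15)] -/
theorem sum_chars_norm_sq_sum_eq [NeZero q] {N : ℕ} (hN : N < q) (c : ℕ → ℂ) :
    ∑ χ : DirichletCharacter ℂ q, ‖∑ n ∈ Finset.range (N + 1), c n * χ (n : ZMod q)‖ ^ 2 =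
      (q.totient : ℝ) * ∑ n ∈ (Finset.range (N + 1)).filter (fun n ↦ n.Coprime q), ‖c n‖ ^ 2 := by
  have h := Literature.NumberTheory.Sieve.LargeSieve.sum_norm_sq_sum_char_mul (q := q)
    (fun b ↦ if b ≤ N then c b else 0)
  have hsub : Finset.range (N + 1) ⊆ Finset.range q := Finset.range_mono (show N + 1 ≤ q by omega)
  have e1 : ∀ χ : DirichletCharacter ℂ q,
      ∑ b ∈ Finset.range q, χ (b : ZMod q) * (if b ≤ N then c b else 0) =
        ∑ n ∈ Finset.range (N + 1), c n * χ (n : ZMod q) := by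
    intro χ
    rw [← Finset.sum_subset hsub (fun b _ hb ↦ by
      have hbN : ¬ b ≤ N := fun h ↦ hb (Finset.mem_range.2 (Nat.lt_succ_of_le h))
      rw [if_neg hbN, mul_zero])]
    refine Finset.sum_congr rfl fun n hn ↦ ?_
    rw [if_pos (Nat.lt_succ_iff.1 (Finset.mem_range.1 hn)), mul_comm]
  have e2 : ∑ b ∈ (Finset.range q).filter (fun b ↦ b.Coprime q), ‖(if b ≤ N then c b else 0)‖ ^ 2 =
      ∑ n ∈ (Finset.range (N + 1)).filter (fun n ↦ n.Coprime q), ‖c n‖ ^ 2 := by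
    rw [← Finset.sum_subset (Finset.filter_subset_filter _ hsub) (fun b hb hb' ↦ by
      have hbN : ¬ b ≤ N := fun h ↦ hb' (Finset.mem_filter.2
        ⟨Finset.mem_range.2 (Nat.lt_succ_of_le h), (Finset.mem_filter.1 hb).2⟩)
      rw [if_neg hbN, norm_zero, zero_pow two_ne_zero])]
    refine Finset.sum_congr rfl fun n hn ↦ ?_
    rw [if_pos (Nat.lt_succ_iff.1 (Finset.mem_range.1 (Finset.mem_filter.1 hn).1))]
  simp_rw [e1] at h
  rw [h, e2]

/-! ## The spike sums `Y_χ(g)` and their second moments -/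

/-- `Σ_χ |Y_χ(g)|² = φ(q) Σ_{n ≤ N, (n,q)=1} (Λ(n)²/n)|(g ⋆ g̃)(log n)|²` for `N < q`, where
`Y_χ(g) = Σ_{n ≤ N} (Λ(n)/√n) χ(n) (g ⋆ g̃)(log n)`. [cite: MontgomeryVaughan2007, Corollary 4.5 (4.15)] -/
theorem sum_chars_norm_sq_spikeSum_eq [NeZero q] {N : ℕ} (hN : N < q) (g : ℝ → ℂ) :
    ∑ χ : DirichletCharacter ℂ q,
        ‖∑ n ∈ Finset.range (N + 1), (((Λ n : ℝ) / Real.sqrt n : ℝ) : ℂ) * weilConv g (weilReflect g) (Real.log n) *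
          χ (n : ZMod q)‖ ^ 2 =
      (q.totient : ℝ) * ∑ n ∈ (Finset.range (N + 1)).filter (fun n ↦ n.Coprime q),
        (Λ n : ℝ) ^ 2 / n * ‖weilConv g (weilReflect g) (Real.log n)‖ ^ 2 := by
  rw [sum_chars_norm_sq_sum_eq hN (fun n ↦ (((Λ n : ℝ) / Real.sqrt n : ℝ) : ℂ) * weilConv g (weilReflect g) (Real.log n))]
  congr 1
  refine Finset.sum_congr rfl fun n _ ↦ ?_
  rw [norm_mul, mul_pow, Complex.norm_real, Real.norm_eq_abs, sq_abs, div_pow,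
    Real.sq_sqrt (Nat.cast_nonneg n)]

/-- For `N² ≤ q` there are no products `mn ≡ 1 (mod q)` with `1 < m, n ≤ N`; hence for coefficients
vanishing at `0` and `1`, `Σ_{χ mod q} (Σ_{n ≤ N} c_n χ(n))² = 0`. [cite: MontgomeryVaughan2007, Corollary 4.5 (4.15)] -/
theorem sum_chars_sum_sq_eq_zero [NeZero q] {N : ℕ} (hN2 : N * N ≤ q) (hq : 2 ≤ q) (c : ℕ → ℂ)
    (hc0 : c 0 = 0) (hc1 : c 1 = 0) :
    ∑ χ : DirichletCharacter ℂ q, (∑ n ∈ Finset.range (N + 1), c n * χ (n : ZMod q)) ^ 2 = 0 := by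
  have e : ∀ χ : DirichletCharacter ℂ q, (∑ n ∈ Finset.range (N + 1), c n * χ (n : ZMod q)) ^ 2 =
      ∑ m ∈ Finset.range (N + 1), ∑ n ∈ Finset.range (N + 1),
        c m * c n * χ ((m * n : ℕ) : ZMod q) := by
    intro χ
    rw [sq, Finset.sum_mul_sum]
    refine Finset.sum_congr rfl fun m _ ↦ Finset.sum_congr rfl fun n _ ↦ ?_
    rw [Nat.cast_mul, map_mul]
    ring
  simp_rw [e]
  rw [Finset.sum_comm]
  refine Finset.sum_eq_zero fun m hm ↦ ?_
  rw [Finset.sum_comm]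
  refine Finset.sum_eq_zero fun n hn ↦ ?_
  rw [← Finset.mul_sum, DirichletCharacter.sum_characters_eq]
  have hmN : m ≤ N := Nat.lt_succ_iff.1 (Finset.mem_range.1 hm)
  have hnN : n ≤ N := Nat.lt_succ_iff.1 (Finset.mem_range.1 hn)
  rcases Nat.lt_or_ge m 2 with hm2 | hm2
  · interval_cases m
    · simp [hc0]
    · simp [hc1]
  rcases Nat.lt_or_ge n 2 with hn2 | hn2
  · interval_cases n
    · simp [hc0]
    · simp [hc1]
  -- 4 ≤ m n ≤ N² ≤ q : the residue of m n is not 1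
  have hne : ((m * n : ℕ) : ZMod q) ≠ 1 := by
    intro h
    have hmn : m * n ≤ q := (Nat.mul_le_mul hmN hnN).trans hN2
    have h4 : 4 ≤ m * n := by nlinarith
    have key := (ZMod.natCast_eq_natCast_iff' (m * n) 1 q).1 (by rw [Nat.cast_one]; exact h)
    rw [Nat.mod_eq_of_lt (lt_of_lt_of_le (by norm_num) hq : 1 < q)] at key
    rcases Nat.lt_or_ge (m * n) q with hlt | hge
    · rw [Nat.mod_eq_of_lt hlt] at key
      omega
    · have : m * n = q := le_antisymm hmn hge
      rw [this, Nat.mod_self] at key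
      omega
  rw [if_neg hne, mul_zero]

/-- In particular `Σ_χ Y_χ(g)² = 0` for `N² ≤ q` (`Λ(0) = Λ(1) = 0`). [cite: MontgomeryVaughan2007, Corollary 4.5 (4.15)] -/
theorem sum_chars_spikeSum_sq_eq_zero [NeZero q] {N : ℕ} (hN2 : N * N ≤ q) (hq : 2 ≤ q) (g : ℝ → ℂ) :
    ∑ χ : DirichletCharacter ℂ q,
        (∑ n ∈ Finset.range (N + 1), (((Λ n : ℝ) / Real.sqrt n : ℝ) : ℂ) *
          weilConv g (weilReflect g) (Real.log n) * χ (n : ZMod q)) ^ 2 = 0 :=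
  sum_chars_sum_sq_eq_zero hN2 hq _ (by simp) (by simp [ArithmeticFunction.vonMangoldt_apply_one])

/-! ## The variance identity -/

/-- The affine law for a character in the `Y_χ` notation:
`E_{χ,N}(g) − E_{a_χ, log q, 0, N}(g) = −2 Re Y_χ(g)`. [cite: Weil1952FormulesExplicites, (11) pp. 261–262] -/
theorem weilFinitePrimeQuadraticChar_sub_zero_key_eq (hg : IsWeilTest g) (χ : DirichletCharacter ℂ q)
    (N : ℕ) :
    weilFinitePrimeQuadraticChar χ N g - weilFinitePrimeQuadraticKey (charParity χ) (Real.log q) 0 N g =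
      -2 * (∑ n ∈ Finset.range (N + 1), (((Λ n : ℝ) / Real.sqrt n : ℝ) : ℂ) *
        weilConv g (weilReflect g) (Real.log n) * χ (n : ZMod q)).re := by
  rw [weilFinitePrimeQuadraticChar_eq_key,
    weilFinitePrimeQuadraticKey_eq_zero_key_sub_spikes hg (charParity χ) (Real.log q) _ N, Complex.re_sum,
    Finset.mul_sum]
  simp only [sub_sub_cancel_left, ← Finset.sum_neg_distrib]
  refine Finset.sum_congr rfl fun n _ ↦ ?_
  have e : ((((Λ n : ℝ) / Real.sqrt n : ℝ) : ℂ) * weilConv g (weilReflect g) (Real.log n) * χ (n : ZMod q)).re =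
      (Λ n : ℝ) / Real.sqrt n * (χ (n : ZMod q) * weilConv g (weilReflect g) (Real.log n)).re := by
    rw [mul_assoc, Complex.re_ofReal_mul, mul_comm (weilConv g (weilReflect g) (Real.log n))]
  rw [e]
  ring

/-- `(2 Re z)² = 2|z|² + 2 Re(z²)`. [folklore] -/
private theorem sq_two_mul_re (z : ℂ) : (2 * z.re) ^ 2 = 2 * ‖z‖ ^ 2 + 2 * (z ^ 2).re := by
  rw [Complex.sq_norm, Complex.normSq_apply, sq z, Complex.mul_re]
  ring

/-- **THE VARIANCE OF THE FAMILY AROUND THE CENTRE.**  For `N < q`, `N² ≤ q` and every test function `g`: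
`Σ_{χ mod q} (E_{χ,N}(g) − E_{a_χ, log q, 0, N}(g))² = 2φ(q) Σ_{n ≤ N, (n,q)=1} (Λ(n)²/n)|(g ⋆ g̃)(log n)|²`.
[cite: MontgomeryVaughan2007, Corollary 4.5 (4.15); Weil1952FormulesExplicites, (11) pp. 261–262] -/
theorem sum_chars_sq_sub_zero_key_eq [NeZero q] (hg : IsWeilTest g) {N : ℕ} (hN : N < q)
    (hN2 : N * N ≤ q) (hq : 2 ≤ q) :
    ∑ χ : DirichletCharacter ℂ q,
        (weilFinitePrimeQuadraticChar χ N g -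
          weilFinitePrimeQuadraticKey (charParity χ) (Real.log q) 0 N g) ^ 2 =
      2 * (q.totient : ℝ) * ∑ n ∈ (Finset.range (N + 1)).filter (fun n ↦ n.Coprime q),
        (Λ n : ℝ) ^ 2 / n * ‖weilConv g (weilReflect g) (Real.log n)‖ ^ 2 := by
  simp_rw [weilFinitePrimeQuadraticChar_sub_zero_key_eq hg _ N]
  have e : ∀ χ : DirichletCharacter ℂ q,
      (-2 * (∑ n ∈ Finset.range (N + 1), (((Λ n : ℝ) / Real.sqrt n : ℝ) : ℂ) *
        weilConv g (weilReflect g) (Real.log n) * χ (n : ZMod q)).re) ^ 2 =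
      2 * ‖∑ n ∈ Finset.range (N + 1), (((Λ n : ℝ) / Real.sqrt n : ℝ) : ℂ) *
        weilConv g (weilReflect g) (Real.log n) * χ (n : ZMod q)‖ ^ 2 +
      2 * ((∑ n ∈ Finset.range (N + 1), (((Λ n : ℝ) / Real.sqrt n : ℝ) : ℂ) *
        weilConv g (weilReflect g) (Real.log n) * χ (n : ZMod q)) ^ 2).re := by
    intro χ
    rw [show (-2 * (∑ n ∈ Finset.range (N + 1), (((Λ n : ℝ) / Real.sqrt n : ℝ) : ℂ) *
        weilConv g (weilReflect g) (Real.log n) * χ (n : ZMod q)).re) ^ 2 =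
      (2 * (∑ n ∈ Finset.range (N + 1), (((Λ n : ℝ) / Real.sqrt n : ℝ) : ℂ) *
        weilConv g (weilReflect g) (Real.log n) * χ (n : ZMod q)).re) ^ 2 by ring]
    exact sq_two_mul_re _
  simp_rw [e]
  rw [Finset.sum_add_distrib, ← Finset.mul_sum, ← Finset.mul_sum, ← Complex.re_sum,
    sum_chars_spikeSum_sq_eq_zero hN2 hq g, Complex.zero_re, mul_zero, add_zero,
    sum_chars_norm_sq_spikeSum_eq hN g]
  ring

/-- The variance is at most `2φ(q) (Σ_{n ≤ N} Λ(n)²/n) ‖g‖₂⁴`, uniformly in `q`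
(`|(g ⋆ g̃)(x)| ≤ ‖g‖₂²`). [cite: Bombieri2000Weil, §4 Lemma 2] -/
theorem sum_chars_sq_sub_zero_key_le [NeZero q] (hg : IsWeilTest g) {N : ℕ} (hN : N < q)
    (hN2 : N * N ≤ q) (hq : 2 ≤ q) :
    ∑ χ : DirichletCharacter ℂ q,
        (weilFinitePrimeQuadraticChar χ N g -
          weilFinitePrimeQuadraticKey (charParity χ) (Real.log q) 0 N g) ^ 2 ≤
      2 * (q.totient : ℝ) * (∑ n ∈ Finset.range (N + 1), (Λ n : ℝ) ^ 2 / n) * weilNorm2Sq g ^ 2 := by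
  rw [sum_chars_sq_sub_zero_key_eq hg hN hN2 hq, mul_assoc (2 * (q.totient : ℝ)), Finset.sum_mul]
  refine mul_le_mul_of_nonneg_left ?_ (by positivity)
  calc ∑ n ∈ (Finset.range (N + 1)).filter (fun n ↦ n.Coprime q),
        (Λ n : ℝ) ^ 2 / n * ‖weilConv g (weilReflect g) (Real.log n)‖ ^ 2
      ≤ ∑ n ∈ Finset.range (N + 1), (Λ n : ℝ) ^ 2 / n * ‖weilConv g (weilReflect g) (Real.log n)‖ ^ 2 :=
        Finset.sum_le_sum_of_subset_of_nonneg (Finset.filter_subset _ _) fun n _ _ ↦ by positivity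
    _ ≤ ∑ n ∈ Finset.range (N + 1), (Λ n : ℝ) ^ 2 / n * weilNorm2Sq g ^ 2 := by
        refine Finset.sum_le_sum fun n _ ↦ mul_le_mul_of_nonneg_left ?_ (by positivity)
        have h := norm_weilConv_weilReflect_le hg (Real.log n)
        have h0 := norm_nonneg (weilConv g (weilReflect g) (Real.log n))
        unfold weilNorm2Sq
        exact pow_le_pow_left₀ h0 h 2

/-! ## Chebyshev: how many characters can fail at a given vector -/

/-- **CHEBYSHEV COUNT.**  For `q ≥ 216`, `N < q`, `N² ≤ q` and every test function `g`, the number of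
characters mod `q` whose window form is negative at `g` satisfies
`#{χ : E_{χ,N}(g) < 0} · (m_q ‖g‖₂²)² ≤ 2φ(q) (Σ_{n ≤ N} Λ(n)²/n) ‖g‖₂⁴`, `m_q = log q − (log π − ψ(¼))`
(for a failing `χ` the deviation from the centre exceeds the centre value `≥ m_q‖g‖₂² ≥ 0`).
[cite: MontgomeryVaughan2007, Corollary 4.5 (4.15); Weil1952FormulesExplicites, (11) pp. 261–262] -/
theorem card_filter_neg_mul_sq_le [NeZero q] (hq : 216 ≤ q) (hg : IsWeilTest g) {N : ℕ} (hN : N < q)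
    (hN2 : N * N ≤ q) :
    ((Finset.univ.filter (fun χ : DirichletCharacter ℂ q ↦ weilFinitePrimeQuadraticChar χ N g < 0)).card : ℝ) *
        ((Real.log q - (Real.log π - (Complex.digamma (1 / 4)).re)) * weilNorm2Sq g) ^ 2 ≤
      2 * (q.totient : ℝ) * (∑ n ∈ Finset.range (N + 1), (Λ n : ℝ) ^ 2 / n) * weilNorm2Sq g ^ 2 := by
  have hq2 : 2 ≤ q := le_trans (by norm_num) hq
  refine le_trans ?_ (sum_chars_sq_sub_zero_key_le hg hN hN2 hq2)
  rw [Finset.card_eq_sum_ones, Nat.cast_sum, Finset.sum_mul, Nat.cast_one]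
  simp only [one_mul]
  refine (Finset.sum_le_sum fun χ hχ ↦ ?_).trans
    (Finset.sum_le_sum_of_subset_of_nonneg (Finset.filter_subset _ _) fun χ _ _ ↦ sq_nonneg _)
  have hneg : weilFinitePrimeQuadraticChar χ N g < 0 := (Finset.mem_filter.1 hχ).2
  have hcentre := weilFinitePrimeQuadraticKey_zero_key_ge hg (charParity χ) (Real.log q) N
  have hth0 := zero_key_threshold_of_ge_216 hq 0 zero_le_one
  have hn := weilNorm2Sq_nonneg g
  -- the even centre value is the smaller one: ψ(¼) ≤ ψ(¼ + a/2)
  have hmono : (Complex.digamma (1 / 4)).re ≤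
      (Complex.digamma ((1 / 4 + (charParity χ : ℝ) / 2 : ℝ) : ℂ)).re := by
    have ha2 : charParity χ = 0 ∨ charParity χ = 1 := by unfold charParity; split_ifs <;> simp
    rcases ha2 with h0 | h1
    · rw [h0]
      have e : (((1 / 4 + ((0 : ℕ) : ℝ) / 2 : ℝ)) : ℂ) = (1 / 4 : ℂ) := by push_cast; norm_num
      rw [e]
    · rw [h1]
      have hπ := Literature.Analysis.SpecialFunctions.Complex.digamma_three_quarters_sub_digamma_one_quarter
      have hre := congrArg Complex.re hπ
      rw [Complex.sub_re, Complex.ofReal_re] at hre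
      have e : (((1 / 4 + ((1 : ℕ) : ℝ) / 2 : ℝ)) : ℂ) = (3 / 4 : ℂ) := by push_cast; norm_num
      rw [e]
      linarith [Real.pi_pos]
  have e0 : (((1 / 4 + ((0 : ℕ) : ℝ) / 2 : ℝ)) : ℂ) = (1 / 4 : ℂ) := by push_cast; norm_num
  rw [e0] at hth0
  -- m_q ‖g‖² ≤ centre ≤ centre − E_χ = −(E_χ − centre), and both sides ≥ 0
  have h1 : 0 ≤ (Real.log q - (Real.log π - (Complex.digamma (1 / 4)).re)) * weilNorm2Sq g :=
    mul_nonneg (by linarith) hn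
  have h2 : (Real.log q - (Real.log π - (Complex.digamma (1 / 4)).re)) * weilNorm2Sq g ≤
      -(weilFinitePrimeQuadraticChar χ N g -
        weilFinitePrimeQuadraticKey (charParity χ) (Real.log q) 0 N g) := by
    have : (Real.log q - (Real.log π - (Complex.digamma (1 / 4)).re)) * weilNorm2Sq g ≤
        ((Complex.digamma ((1 / 4 + (charParity χ : ℝ) / 2 : ℝ) : ℂ)).re + (Real.log q - Real.log π)) *
          weilNorm2Sq g := by
      refine mul_le_mul_of_nonneg_right ?_ hn
      linarith
    linarith
  calc ((Real.log q - (Real.log π - (Complex.digamma (1 / 4)).re)) * weilNorm2Sq g) ^ 2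
      ≤ (-(weilFinitePrimeQuadraticChar χ N g -
          weilFinitePrimeQuadraticKey (charParity χ) (Real.log q) 0 N g)) ^ 2 :=
        pow_le_pow_left₀ h1 h2 2
    _ = _ := by ring

end Summit.Ventures.WeilGRH
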